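import Summits.HodgeConjecture.HodgeConjecture.Theses.TropicalWeilObstruction
import Summits.HodgeConjecture.HodgeConjecture.Theorems.TropicalWeilObstructionTropicalHodgeBoundCycleClassRational
import Summits.HodgeConjecture.HodgeConjecture.Theorems.TropicalWeilObstructionTropicalWeilVanishingSimplexDeterminants
import HarnessLib

/-!
# Route `TropicalWeilObstruction` (Kontsevich's tropical test — NEGATION SINK, exploration, no summit claim):
# the degree ladder of K1 — I. one discrete Stokes step: `4 ∣ intCoord Z`

Negation-sink bookkeeping of the cell `pub-hodge-tropical` (seat tropical-1 gen 7); part I of the DEGREE LADDER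
(part II: `…TropicalWeilVanishingDegreeLadder`). K3's integrality (`cyc_eq_sum_det_mul_intCoord`, file
`…TropicalHodgeBoundCycleClassRational`, p322554's part R3) writes the class of an effective tropical `4`-cycle `Z` on
`ℝᵍ/Qℤᵍ` as `cyc Z (S,S') = 576⁻¹ Σ_I det Q[S,I] · intCoord Z (I,S')` with an INTEGER table
`intCoord Z (I,S') = Σ_σ w_σ Δ_{S'}(L_σ) · det [ū_{σ,j+1} - ū_{σ,0}]_I`, `ū = ⌊Q⁻¹ v⌋` the floored period coordinates
of the vertices. Topologically `[Z] ∈ H₄(X_Q; ⋀⁴ℤᵍ) = ⋀⁴(Qℤᵍ) ⊗ ⋀⁴ℤᵍ` forces `24 ∣ intCoord Z`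
[cite: MikhalkinZharkov2014Eigenwave, Prop. 4.3]; the tree's discrete Stokes argument sees none of this divisibility.
This file proves the first factor `4` of it inside the certificate format, by ONE algebraic Stokes step:

* `det_sub_eq_sum_sign_potential` — the exactness `dx_I = d(x_{I₀} dx_{I₁I₂I₃})` on a `4`-simplex with vertices
  `x₀,…,x₄`: `det [x_{j+1} - x_0] = Σ_i (-1)^i E(x ∘ δ_i)` with the facet potential
  `E(y₀,…,y₃) = (Σ_m y_{m,0}) · det [(y_{j+1} - y_0)_{a+1}]` (a polynomial identity, any commutative ring);
* `potential_comp_perm`, `potential_add_const` — `E` is alternating in the four points and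
  `E(y + t) = E(y) + 4 t₀ · det [(y_{j+1} - y_0)_{a+1}]`: a translate of a facet changes `E` by FOUR times an integer;
* `intCoord_eq_four_mul`, `four_dvd_intCoord` — summing over the cells of `Z`: the facets of one class are
  `ℤᵍ`-translates of the floored reference facet (`facet_eq`, `⌊x + k⌋ = ⌊x⌋ + k`), the `E(reference facet)` terms cancel
  class by class (`balanced`), and what remains is `4 · Σ_{slots} ± w_σ Δ_{S'}(L_σ) k_{σ,i,I₀} det₃(reference facet)`.

Consequence (part II): at a Weil-generic period the K3 coordinates `(q₀,q₁,q₂)` of `cyc Z` lie in `(1/6)ℤ³` (K3 alone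
gives `(1/24)ℤ³`), so the calibration cone `64(q₁²+q₂²) ≤ q₀²` forces `W(Z) = 0` whenever `q₀ < 4/3`.

HONEST STATUS. Elementary algebra on the certificate format; decides nothing about K1 (`TropicalWeilVanishing`,
stmt-HodgeConjecture-18478, an OPEN problem) or about the Hodge conjecture. No definition (display-only notation),
no named fact, no sorry.

References: [MikhalkinZharkov2014Eigenwave] G. Mikhalkin, I. Zharkov, Tropical eigenwave and intermediate Jacobians,
LN UMI 15 (2014), Def. 4.2, Prop. 4.3; [Zharkov2020TropicalWeil] I. Zharkov, arXiv:2002.02347, p. 2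
("`vol(Z) ∈ ⋀ᵖΓ₁ ⊗ ⋀ᵖΓ₂`").
-/

set_option linter.dupNamespace false

noncomputable section

open scoped BigOperators
open Matrix
open Literature.AlgebraicGeometry.Tropical
open Summit.HodgeConjecture.HodgeConjecture.Theorems.TropicalHodgeBound

namespace Summit.HodgeConjecture.HodgeConjecture.Theorems.TropicalWeilVanishing.Ladder

/-! ## §0 Display-only notation (nothing is defined) -/

/-- The facet potential `E(y) = (Σ_m y_{m,0}) · det [(y_{j+1} - y_0)_{a+1}]_{j,a<3}` of four points
`y₀,…,y₃` with four coordinates (`24 ∫_{[y]} x₀ dx₁ ∧ dx₂ ∧ dx₃`). Nothing is defined. -/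
local notation3 (prettyPrint := false) "𝐄⟦" y "⟧" =>
  ((∑ m : Fin 4, y m (0 : Fin 4)) *
    Matrix.det (Matrix.of fun (j : Fin 3) (a : Fin 3) => y (Fin.succ j) (Fin.succ a) - y 0 (Fin.succ a)))

/-- The facet `3`-volume `det [(y_{j+1} - y_0)_{a+1}]_{j,a<3}`. Nothing is defined. -/
local notation3 (prettyPrint := false) "𝐕⟦" y "⟧" =>
  (Matrix.det (Matrix.of fun (j : Fin 3) (a : Fin 3) => y (Fin.succ j) (Fin.succ a) - y 0 (Fin.succ a)))

/-! ## §1 One algebraic Stokes step on a `4`-simplex -/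

section Stokes

variable {R : Type*} [CommRing R]

/-- **Exactness `dx_I = d(x_{I₀} dx_{I₁I₂I₃})` on a simplex**: for five points `x₀,…,x₄` with four coordinates,
`det [x_{j+1} - x_0]_{j,a} = Σ_i (-1)^i E(x₀,…,x̂ᵢ,…,x₄)`. A polynomial identity. [folklore] -/
theorem det_sub_eq_sum_sign_potential (x : Fin 5 → Fin 4 → R) :
    (Matrix.of fun j a : Fin 4 => x j.succ a - x 0 a).det =
      ∑ i : Fin 5, (-1) ^ (i : ℕ) * 𝐄⟦fun k => x (i.succAbove k)⟧ := by
  simp only [Matrix.det_succ_row_zero, Fin.sum_univ_succ, Fin.sum_univ_zero, Matrix.of_apply,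
    Matrix.submatrix_apply, Fin.succAbove]
  simp
  ring

/-- The facet potential is alternating in the four points. [folklore] -/
theorem potential_comp_perm (y : Fin 4 → Fin 4 → R) (π : Equiv.Perm (Fin 4)) :
    𝐄⟦fun k => y (π k)⟧ = ((Equiv.Perm.sign π : ℤˣ) : ℤ) * 𝐄⟦y⟧ := by
  have hsum : ∑ m : Fin 4, y (π m) (0 : Fin 4) = ∑ m : Fin 4, y m 0 := Equiv.sum_comp π (fun m => y m 0)
  have hdet := det_sub_perm (fun (k : Fin 4) (a : Fin 3) => y k a.succ) π
  have e1 : (Matrix.of fun (j : Fin 3) (a : Fin 3) => y (π j.succ) a.succ - y (π 0) a.succ) =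
      Matrix.of fun j : Fin 3 => (fun (k : Fin 4) (a : Fin 3) => y k a.succ) (π j.succ) -
        (fun (k : Fin 4) (a : Fin 3) => y k a.succ) (π 0) := by
    ext j a; rfl
  have e2 : (Matrix.of fun (j : Fin 3) (a : Fin 3) => y j.succ a.succ - y 0 a.succ) =
      Matrix.of fun j : Fin 3 => (fun (k : Fin 4) (a : Fin 3) => y k a.succ) j.succ -
        (fun (k : Fin 4) (a : Fin 3) => y k a.succ) 0 := by
    ext j a; rfl
  rw [hsum, e1, hdet, ← e2]
  ring

/-- Translating the four points by `t` changes the potential by `4 t₀` times the facet volume: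
`E(y + t) = E(y) + 4 t₀ det [(y_{j+1} - y_0)_{a+1}]`. [folklore] -/
theorem potential_add_const (y : Fin 4 → Fin 4 → R) (t : Fin 4 → R) :
    𝐄⟦fun k a => y k a + t a⟧ = 𝐄⟦y⟧ + 4 * t 0 * 𝐕⟦y⟧ := by
  have hsum : ∑ m : Fin 4, (y m (0 : Fin 4) + t 0) = (∑ m : Fin 4, y m 0) + 4 * t 0 := by
    rw [Finset.sum_add_distrib, Finset.sum_const, Finset.card_univ, Fintype.card_fin, nsmul_eq_mul]
    norm_num
  have hdet : (Matrix.of fun (j : Fin 3) (a : Fin 3) => (y j.succ a.succ + t a.succ) - (y 0 a.succ + t a.succ)) =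
      Matrix.of fun (j : Fin 3) (a : Fin 3) => y j.succ a.succ - y 0 a.succ := by
    ext j a; simp only [Matrix.of_apply, add_sub_add_right_eq_sub]
  rw [hsum, hdet]
  ring

end Stokes

/-! ## §2 The chain: `4 ∣ intCoord Z` -/

section Chain

variable {g : ℕ} {Q : Matrix (Fin g) (Fin g) ℝ}

/-- **`intCoord Z` is four times an integer**, explicitly: with `ρ̄_f = ⌊Q⁻¹ r_f⌋` the floored reference facets,
`intCoord Z (I,S') = 4 · Σ_{σ,i} w_σ Δ_{S'}(L_σ) (-1)^i sign(π_{σ,i}) · k_{σ,i,I₀} · det [(ρ̄_{f(σ,i),j+1} - ρ̄_{f(σ,i),0})_{I_{a+1}}]`.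
[cite: MikhalkinZharkov2014Eigenwave, Prop. 4.3] -/
theorem intCoord_eq_four_mul (hQ : IsUnit Q.det) (Z : TropicalTorusCycle g 4 Q) (I S' : Fin 4 → Fin g) :
    intCoord Z I S' = 4 * ∑ σ, ∑ i : Fin 5,
      ((Z.cell σ).weight : ℤ) * pluckerCoord (Z.cell σ).frame S' * (-1) ^ (i : ℕ) *
        ((Equiv.Perm.sign (Z.facetPerm σ i) : ℤˣ) : ℤ) *
        (Z.facetShift σ i (I 0) *
          𝐕⟦fun (k : Fin 4) (a : Fin 4) => ⌊(Q⁻¹ *ᵥ Z.refFacet (Z.facetClass σ i) k) (I a)⌋⟧) := by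
  classical
  -- floored period coordinates of the vertices and of the reference facets
  set u : Fin Z.numCells → Fin 5 → Fin g → ℤ := fun σ k r => ⌊(Q⁻¹ *ᵥ (Z.cell σ).vertex k) r⌋ with hu
  set ρ : Fin Z.numFacetClasses → Fin 4 → Fin g → ℤ := fun f j r => ⌊(Q⁻¹ *ᵥ Z.refFacet f j) r⌋ with hρ
  -- the facets are integer translates of the floored reference facets
  have hfacet : ∀ σ i j r, u σ (i.succAbove (Z.facetPerm σ i j)) r =
      ρ (Z.facetClass σ i) j r + Z.facetShift σ i r := by
    intro σ i j r
    have hv : (Z.cell σ).vertex (i.succAbove (Z.facetPerm σ i j)) =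
        Z.refFacet (Z.facetClass σ i) j + Q *ᵥ fun b => (Z.facetShift σ i b : ℝ) := by
      funext a; rw [Z.facet_eq σ i j a]; rfl
    simp only [hu, hρ, hv, Matrix.mulVec_add, Matrix.mulVec_mulVec, Matrix.nonsing_inv_mul Q hQ,
      Matrix.one_mulVec, Pi.add_apply, Int.floor_add_intCast]
  -- abbreviations: coefficient, restricted points, restricted reference facets
  set n : Fin Z.numCells → ℤ := fun σ => ((Z.cell σ).weight : ℤ) * pluckerCoord (Z.cell σ).frame S' with hn
  set x : Fin Z.numCells → Fin 5 → Fin 4 → ℤ := fun σ k a => u σ k (I a) with hx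
  set y : Fin Z.numFacetClasses → Fin 4 → Fin 4 → ℤ := fun f k a => ρ f k (I a) with hy
  -- Step 1: Stokes on every cell
  have hcell : ∀ σ, (Matrix.of fun (j : Fin 4) (a : Fin 4) =>
      ⌊(Q⁻¹ *ᵥ (Z.cell σ).vertex j.succ) (I a)⌋ - ⌊(Q⁻¹ *ᵥ (Z.cell σ).vertex 0) (I a)⌋).det =
      ∑ i : Fin 5, (-1) ^ (i : ℕ) * 𝐄⟦fun k => x σ (i.succAbove k)⟧ := by
    intro σ
    rw [← det_sub_eq_sum_sign_potential (x σ)]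
  -- Step 2: every facet term is `sign π · (E(reference facet) + 4 k_{I₀} det₃(reference facet))`
  have hslot : ∀ σ i, 𝐄⟦fun k => x σ (i.succAbove k)⟧ =
      ((Equiv.Perm.sign (Z.facetPerm σ i) : ℤˣ) : ℤ) *
        (𝐄⟦y (Z.facetClass σ i)⟧ + 4 * Z.facetShift σ i (I 0) * 𝐕⟦y (Z.facetClass σ i)⟧) := by
    intro σ i
    have hs2 : ((Equiv.Perm.sign (Z.facetPerm σ i) : ℤˣ) : ℤ) *
        ((Equiv.Perm.sign (Z.facetPerm σ i) : ℤˣ) : ℤ) = 1 := by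
      rw [← Units.val_mul, Int.units_mul_self, Units.val_one]
    have hperm := potential_comp_perm (fun k => x σ (i.succAbove k)) (Z.facetPerm σ i)
    have hre : (fun k => (fun k => x σ (i.succAbove k)) ((Z.facetPerm σ i) k)) =
        fun k a => y (Z.facetClass σ i) k a + (fun a => Z.facetShift σ i (I a)) a := by
      funext k a
      simp only [hx, hy, hfacet]
    rw [hre] at hperm
    have hadd := potential_add_const (y (Z.facetClass σ i)) (fun a => Z.facetShift σ i (I a))
    beta_reduce at hperm hadd ⊢
    linear_combination (-((Equiv.Perm.sign (Z.facetPerm σ i) : ℤˣ) : ℤ)) * hperm -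
      𝐄⟦fun k => x σ (i.succAbove k)⟧ * hs2 + (((Equiv.Perm.sign (Z.facetPerm σ i) : ℤˣ) : ℤ)) * hadd
  -- Step 3: the `E(reference facet)` terms cancel class by class (`balanced`)
  have hbal : ∑ σ, ∑ i : Fin 5, n σ * (-1) ^ (i : ℕ) * ((Equiv.Perm.sign (Z.facetPerm σ i) : ℤˣ) : ℤ) *
      𝐄⟦y (Z.facetClass σ i)⟧ = 0 := by
    have hreg : ∀ σ (i : Fin 5), n σ * (-1) ^ (i : ℕ) * ((Equiv.Perm.sign (Z.facetPerm σ i) : ℤˣ) : ℤ) *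
        𝐄⟦y (Z.facetClass σ i)⟧ =
        ∑ f, 𝐄⟦y f⟧ * (if Z.facetClass σ i = f then
          ((Z.cell σ).weight : ℤ) * (-1) ^ (i : ℕ) * ((Equiv.Perm.sign (Z.facetPerm σ i) : ℤˣ) : ℤ) *
            pluckerCoord (Z.cell σ).frame S' else 0) := by
      intro σ i
      rw [Finset.sum_eq_single (Z.facetClass σ i)]
      · rw [if_pos rfl, hn]; ring
      · intro f _ hf; rw [if_neg (Ne.symm hf), mul_zero]
      · intro h; exact absurd (Finset.mem_univ _) h
    simp_rw [hreg]
    calc ∑ σ, ∑ i : Fin 5, ∑ f, 𝐄⟦y f⟧ * (if Z.facetClass σ i = f then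
            ((Z.cell σ).weight : ℤ) * (-1) ^ (i : ℕ) * ((Equiv.Perm.sign (Z.facetPerm σ i) : ℤˣ) : ℤ) *
              pluckerCoord (Z.cell σ).frame S' else 0)
        = ∑ σ, ∑ f, ∑ i : Fin 5, 𝐄⟦y f⟧ * (if Z.facetClass σ i = f then
            ((Z.cell σ).weight : ℤ) * (-1) ^ (i : ℕ) * ((Equiv.Perm.sign (Z.facetPerm σ i) : ℤˣ) : ℤ) *
              pluckerCoord (Z.cell σ).frame S' else 0) := Finset.sum_congr rfl fun σ _ => Finset.sum_comm
      _ = ∑ f, ∑ σ, ∑ i : Fin 5, 𝐄⟦y f⟧ * (if Z.facetClass σ i = f then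
            ((Z.cell σ).weight : ℤ) * (-1) ^ (i : ℕ) * ((Equiv.Perm.sign (Z.facetPerm σ i) : ℤˣ) : ℤ) *
              pluckerCoord (Z.cell σ).frame S' else 0) := Finset.sum_comm
      _ = ∑ f, 𝐄⟦y f⟧ * ∑ σ, ∑ i : Fin 5, (if Z.facetClass σ i = f then
            ((Z.cell σ).weight : ℤ) * (-1) ^ (i : ℕ) * ((Equiv.Perm.sign (Z.facetPerm σ i) : ℤˣ) : ℤ) *
              pluckerCoord (Z.cell σ).frame S' else 0) := by
          refine Finset.sum_congr rfl fun f _ => ?_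
          rw [Finset.mul_sum]
          exact Finset.sum_congr rfl fun σ _ => by rw [Finset.mul_sum]
      _ = 0 := Finset.sum_eq_zero fun f _ => by rw [Z.balanced f S', mul_zero]
  -- assemble
  unfold intCoord
  calc ∑ σ, ((Z.cell σ).weight : ℤ) * pluckerCoord (Z.cell σ).frame S' *
        (Matrix.of fun (j : Fin 4) (a : Fin 4) =>
          ⌊(Q⁻¹ *ᵥ (Z.cell σ).vertex j.succ) (I a)⌋ - ⌊(Q⁻¹ *ᵥ (Z.cell σ).vertex 0) (I a)⌋).det
      = ∑ σ, ∑ i : Fin 5, n σ * (-1) ^ (i : ℕ) * ((Equiv.Perm.sign (Z.facetPerm σ i) : ℤˣ) : ℤ) *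
          (𝐄⟦y (Z.facetClass σ i)⟧ + 4 * Z.facetShift σ i (I 0) * 𝐕⟦y (Z.facetClass σ i)⟧) := by
        refine Finset.sum_congr rfl fun σ _ => ?_
        rw [hcell σ, Finset.mul_sum]
        refine Finset.sum_congr rfl fun i _ => ?_
        rw [hslot σ i, hn]
        ring
    _ = ∑ σ, ∑ i : Fin 5, n σ * (-1) ^ (i : ℕ) * ((Equiv.Perm.sign (Z.facetPerm σ i) : ℤˣ) : ℤ) *
          𝐄⟦y (Z.facetClass σ i)⟧ +
        4 * ∑ σ, ∑ i : Fin 5, n σ * (-1) ^ (i : ℕ) * ((Equiv.Perm.sign (Z.facetPerm σ i) : ℤˣ) : ℤ) *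
          (Z.facetShift σ i (I 0) * 𝐕⟦y (Z.facetClass σ i)⟧) := by
        rw [Finset.mul_sum, ← Finset.sum_add_distrib]
        refine Finset.sum_congr rfl fun σ _ => ?_
        rw [Finset.mul_sum, ← Finset.sum_add_distrib]
        refine Finset.sum_congr rfl fun i _ => ?_
        ring
    _ = _ := by rw [hbal, zero_add]

/-- **`4 ∣ intCoord Z (I,S')`** for every effective tropical `4`-cycle on `ℝᵍ/Qℤᵍ` (`det Q ≠ 0`) and all words
`I, S'`. (Topologically `24 ∣ intCoord Z`; the certificate format yields the factor `4` by one Stokes step.)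
[cite: MikhalkinZharkov2014Eigenwave, Prop. 4.3] -/
theorem four_dvd_intCoord (hQ : IsUnit Q.det) (Z : TropicalTorusCycle g 4 Q) (I S' : Fin 4 → Fin g) :
    (4 : ℤ) ∣ intCoord Z I S' :=
  ⟨_, intCoord_eq_four_mul hQ Z I S'⟩

/-- **The cycle class with the factor `4` removed**: `cyc Z (S,S') = 144⁻¹ Σ_I det Q[S,I] · (intCoord Z (I,S') / 4)`,
the quotient being an integer. [cite: MikhalkinZharkov2014Eigenwave, Prop. 4.3] -/
theorem cyc_eq_sum_det_mul_intCoord_div_four (hQ : IsUnit Q.det) (Z : TropicalTorusCycle g 4 Q)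
    (S S' : Fin 4 → Fin g) :
    Z.cyc S S' = (1 / 144 : ℝ) * ∑ I : Fin 4 → Fin g,
      (Q.submatrix S I).det * ((intCoord Z I S' / 4 : ℤ) : ℝ) := by
  rw [cyc_eq_sum_det_mul_intCoord hQ Z S S',
    show (1 / 576 : ℝ) = (1 / 144 : ℝ) * (1 / 4 : ℝ) by norm_num, mul_assoc, Finset.mul_sum]
  congr 1
  refine Finset.sum_congr rfl fun I _ => ?_
  have h4 := Int.ediv_mul_cancel (four_dvd_intCoord hQ Z I S')
  have hc : ((intCoord Z I S' : ℤ) : ℝ) = ((intCoord Z I S' / 4 : ℤ) : ℝ) * 4 := by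
    exact_mod_cast h4.symm
  rw [hc]
  ring

end Chain

end Summit.HodgeConjecture.HodgeConjecture.Theorems.TropicalWeilVanishing.Ladder

end
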